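import Summits.ResolutionOfSingularities.ResolutionOfSingularities.Theorems.WeightedInvariantKeyRungThreeOfClauses
import Summits.ResolutionOfSingularities.ResolutionOfSingularities.Theorems.WeightedInvariantTieFreeAlongCurve
import Summits.ResolutionOfSingularities.ResolutionOfSingularities.Theorems.WeightedInvariantJOpenPresentationCrossing
import Summits.ResolutionOfSingularities.ResolutionOfSingularities.Theorems.WeightedInvariantJOpenPresentationIsolatedPoint
import Summits.ResolutionOfSingularities.ResolutionOfSingularities.Theorems.WeightedInvariantJOpenPresentationTiePoint
import Summits.ResolutionOfSingularities.ResolutionOfSingularities.Theorems.WeightedInvariantIota3SigmaPresentationOfDominance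
import HarnessLib

/-!
# W4.3 door 19897 — P3 rung `KeyRungGrHomLE 3 p` for the named pair `(ι₃ᵗ, J₃ᵗ) = (Iota3.iotaFlatT, Iota3.jFlatT)`:
# the gap list of `keyRungGrHomLE_three_of_open_clauses` SHRUNK from nine hypotheses to six

Route `ResolutionOfSingularities/WeightedInvariant`, crux `Theses.WeightedInvariant.HypersurfaceCentreConstruction`
(stmt-ResolutionOfSingularities-19897), door line `local-engine` (skeleton v3.12, `7a4b52ef4f5779aa`), registered stub
`stub_keyRungGrHomLE_three : ∀ p, p.Prime → KeyRungGrHomLE 3 p`.  The audit theorem `keyRungGrHomLE_three_of_open_clauses`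
(…KeyRungThreeOfClauses) takes NINE hypotheses `hc8 hc10 hc11 hgame hT hP00 hP01 hP10 hgr`.  Three of the four h8-inputs are now
unconditional tree theorems or follow from ONE word:
* (T) `TieFreeAlongCurveLE3 p` is `JOpenLE3.tieFreeAlongCurveLE3 p` (…TieFreeAlongCurve, from `TieFinite.finite_tiePrimes_over`);
* (P₁₀) `PointBodyLE3 p 1 0` is `JOpenLE3.pointBodyLE3_one_zero p` (…JOpenPresentationCrossing);
* (P₀₀) `PointBodyLE3 p 0 0` and (P₀₁) `PointBodyLE3 p 0 1` follow from (σ-pres)₃ = `SigmaPresentationLE3Body p`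
  (`JOpenLE3.pointBodyLE3_zero_zero_of` / `JOpenLE3.pointBodyLE3_zero_one_of`), and (σ-pres)₃ follows from the ONE dominance word
  `TwoFlagDominanceAtLevelLE3Body p` (`sigmaPresentationLE3_of_dominance`, …Iota3SigmaPresentationOfDominance).
Hence `KeyRungGrHomLE 3 p` for the named pair from SIX hypotheses: (c8)≤3, (c10)≤3, (c11)≤3, (c9′-hom)≤3, the dominance word, (c8-gr)≤3
(`keyRungGrHomLE_three_of_dominance`), and the intermediate form with (σ-pres)₃ in place of the dominance word
(`keyRungGrHomLE_three_of_sigmaPresentation`).  The hypothesis list IS the honest gap list of the rung after this file.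
[OURS · L1 W4.3 · audit glue for the door item; candidates stay candidates; nothing here is a statement of H. Hironaka's 2017 manuscript;
AI-written, weaker than expert review; no claim about resolution of singularities in characteristic `p` beyond the typed statements.]
No definition; no new axiom; no named fact taken as hypothesis beyond the clause words of the line.
-/

noncomputable section

set_option linter.dupNamespace false -- mandated namespace of this single-conjunct summit

open Summit.ResolutionOfSingularities.ResolutionOfSingularities.Theorems
open Summit.ResolutionOfSingularities.ResolutionOfSingularities.Theorems.JOpenLE3

namespace Summit.ResolutionOfSingularities.ResolutionOfSingularities.Cruxes.HypersurfaceCentreConstruction.LocalEngine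

open Iota3

/-- The two `ε = 0` point bodies (P₀₀) and (P₀₁) of the (open″)≤3 assembly from (σ-pres)₃ `SigmaPresentationLE3Body p`
(reshuffle of `JOpenLE3.pointBodyLE3_zero_zero_of` / `JOpenLE3.pointBodyLE3_zero_one_of` through the tree name of their common
hypothesis). [OURS · audit glue] -/
theorem pointBodyLE3_zero_of_sigmaPresentation (p : ℕ) (hσ : SigmaPresentationLE3Body p) :
    PointBodyLE3 p 0 0 ∧ PointBodyLE3 p 0 1 :=
  ⟨pointBodyLE3_zero_zero_of p (fun k₀ _ _ _ S _ _ _ _ f => hσ k₀ S f),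
    pointBodyLE3_zero_one_of p (fun k₀ _ _ _ S _ _ _ _ f => hσ k₀ S f)⟩

/-- h8 `JOpenPresentationForallSingLE 3 p iotaFlatT jFlatT` from (σ-pres)₃ ALONE: (T) and (P₁₀) are tree theorems, (P₀₀)/(P₀₁) come
from (σ-pres)₃. [OURS · audit glue] -/
theorem jOpenPresentationForallSingLE_three_of_sigmaPresentation (p : ℕ) (hσ : SigmaPresentationLE3Body p) :
    JOpenPresentationForallSingLE 3 p iotaFlatT jFlatT :=
  jOpenPresentationForallSingLE_three_of_points p (pointBodyLE3_zero_of_sigmaPresentation p hσ).1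
    (pointBodyLE3_zero_of_sigmaPresentation p hσ).2 (pointBodyLE3_one_zero p)

/-- h8 `JOpenPresentationForallSingLE 3 p iotaFlatT jFlatT` from the ONE dominance word `TwoFlagDominanceAtLevelLE3Body p`.
[OURS · audit glue] -/
theorem jOpenPresentationForallSingLE_three_of_dominance (p : ℕ) (hDom : TwoFlagDominanceAtLevelLE3Body p) :
    JOpenPresentationForallSingLE 3 p iotaFlatT jFlatT :=
  jOpenPresentationForallSingLE_three_of_sigmaPresentation p (sigmaPresentationLE3_of_dominance p hDom)

/-- **P3 RUNG FOR THE NAMED PAIR MODULO SIX CLAUSES, (σ-pres)₃ form**: `KeyRungGrHomLE 3 p` for `(iotaFlatT, jFlatT)` from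
(c8)≤3, (c10)≤3, (c11)≤3, (c9′-hom)≤3, (σ-pres)₃ and (c8-gr)≤3; (T) and (P₁₀) discharged by the tree theorems
`JOpenLE3.tieFreeAlongCurveLE3` / `JOpenLE3.pointBodyLE3_one_zero`, (P₀₀)/(P₀₁) by (σ-pres)₃. [OURS · audit glue] -/
theorem keyRungGrHomLE_three_of_sigmaPresentation (p : ℕ)
    (hc8 : IotaUpperSemicontinuousLE 3 p iotaFlatT)
    (hc10 : IotaTorusFactorMonotoneLE 3 p iotaFlatT)
    (hc11 : IotaJEssSmoothCompatibleLE 3 iotaFlatT jFlatT)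
    (hgame : CanonicalGameClauseHomLE 3 p iotaFlatT jFlatT)
    (hσ : SigmaPresentationLE3Body p)
    (hgr : IotaUpperSemicontinuousGradedLE 3 p iotaFlatT) :
    KeyRungGrHomLE 3 p :=
  keyRungGrHomLE_three_of_open_clauses p hc8 hc10 hc11 hgame (tieFreeAlongCurveLE3 p)
    (pointBodyLE3_zero_of_sigmaPresentation p hσ).1 (pointBodyLE3_zero_of_sigmaPresentation p hσ).2
    (pointBodyLE3_one_zero p) hgr

/-- **P3 RUNG FOR THE NAMED PAIR MODULO SIX CLAUSES, dominance form**: `KeyRungGrHomLE 3 p` for `(iotaFlatT, jFlatT)` from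
(c8)≤3, (c10)≤3, (c11)≤3, (c9′-hom)≤3, the ONE dominance word `TwoFlagDominanceAtLevelLE3Body p`, and (c8-gr)≤3.  The hypothesis
list is the gap list of the registered stub `stub_keyRungGrHomLE_three` after this file. [OURS · audit glue] -/
theorem keyRungGrHomLE_three_of_dominance (p : ℕ)
    (hc8 : IotaUpperSemicontinuousLE 3 p iotaFlatT)
    (hc10 : IotaTorusFactorMonotoneLE 3 p iotaFlatT)
    (hc11 : IotaJEssSmoothCompatibleLE 3 iotaFlatT jFlatT)
    (hgame : CanonicalGameClauseHomLE 3 p iotaFlatT jFlatT)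
    (hDom : TwoFlagDominanceAtLevelLE3Body p)
    (hgr : IotaUpperSemicontinuousGradedLE 3 p iotaFlatT) :
    KeyRungGrHomLE 3 p :=
  keyRungGrHomLE_three_of_sigmaPresentation p hc8 hc10 hc11 hgame (sigmaPresentationLE3_of_dominance p hDom) hgr

/-- The same in the registrar's `∀ p` shape of `stub_keyRungGrHomLE_three`. [OURS · audit glue] -/
theorem keyRungGrHomLE_three_forall_of_dominance
    (hc8 : ∀ p : ℕ, p.Prime → IotaUpperSemicontinuousLE 3 p iotaFlatT)
    (hc10 : ∀ p : ℕ, p.Prime → IotaTorusFactorMonotoneLE 3 p iotaFlatT)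
    (hc11 : IotaJEssSmoothCompatibleLE 3 iotaFlatT jFlatT)
    (hgame : ∀ p : ℕ, p.Prime → CanonicalGameClauseHomLE 3 p iotaFlatT jFlatT)
    (hDom : ∀ p : ℕ, p.Prime → TwoFlagDominanceAtLevelLE3Body p)
    (hgr : ∀ p : ℕ, p.Prime → IotaUpperSemicontinuousGradedLE 3 p iotaFlatT) :
    ∀ p : ℕ, p.Prime → KeyRungGrHomLE 3 p :=
  fun p hp => keyRungGrHomLE_three_of_dominance p (hc8 p hp) (hc10 p hp) hc11 (hgame p hp) (hDom p hp) (hgr p hp)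

end Summit.ResolutionOfSingularities.ResolutionOfSingularities.Cruxes.HypersurfaceCentreConstruction.LocalEngine

end
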